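import Mathlib.RingTheory.Regular.Flat
import Mathlib.RingTheory.Regular.RegularSequence
import Mathlib.RingTheory.Ideal.Height
import Mathlib.RingTheory.Localization.AtPrime.Basic
import Mathlib.RingTheory.Localization.Submodule
import Mathlib.Data.List.OfFn
import Summits.ResolutionOfSingularities.ResolutionOfSingularities.Theorems.FrobeniusLadderFRationalModificationSopWeaklyRegular
import Literature.RingTheory.TightClosure.TightClosure
import HarnessLib

/-!
# Cohen–Macaulayness localizes, s.o.p. form (crux `FrobeniusLadder.FInjectiveMacaulayfication`, line `Sketch`)

Stub `stub_cmLocalizes` of the skeleton `Sketch` for crux stmt-ResolutionOfSingularities-15315 (route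
`FrobeniusLadder`; cycle 4, wave 2: the clause "every system of parameters is a weakly regular
sequence" passes from a Noetherian local ring `R` to its localizations `R_P`).

Setting. `(R, 𝔪)` is a Noetherian local ring in which every system of parameters
(`Literature.RingTheory.TightClosure.IsSystemOfParameters`: `dim R` elements generating an
`𝔪`-primary ideal) is a weakly regular sequence; `P` is a prime of height `h`; and we are handed a
system of parameters `Fin.append x t` of `R` whose head `x : Fin h → R` lies in `P` (the neighbour
stub `stub_sopThroughPrime` produces these data; the extra hypothesis "`P` is a minimal prime of
`(x)`" is carried for symmetry and not used here).

Proof [Matsumura1987, Thm 17.3 (iii)]. The whole sequence `(x, t)` is weakly regular on `R`, hence so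
is its prefix `x` (`RingTheory.Sequence.isWeaklyRegular_append_iff`, `List.ofFn_fin_append`). Since
`x ⊆ P`, the image of `x` in `R_P` is an `R_P`-regular sequence
(`RingTheory.Sequence.IsWeaklyRegular.isRegular_of_isLocalization_of_mem`) contained in the maximal
ideal `P R_P` (`IsLocalization.AtPrime.to_map_mem_maximal_iff`), of length `h = ht P = dim R_P`
(`IsLocalization.AtPrime.ringKrullDim_eq_height`). So `R_P` is Cohen–Macaulay in the tree's phrasing,
and every system of parameters of `R_P` is weakly regular by
`FRationalModification.SopWeaklyRegular.stub_sopWeaklyRegular` (Matsumura, Thm 17.4 (iii)).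

## References

* [Matsumura1987] H. Matsumura, *Commutative Ring Theory*, CUP 1986, Thm. 17.3 (iii)
  (a localization of a Cohen–Macaulay local ring is Cohen–Macaulay) and Thm. 17.4 (iii).
-/

-- single-problem summit: the doubled namespace component is forced
set_option linter.dupNamespace false

open IsLocalRing RingTheory.Sequence Literature.RingTheory.TightClosure

namespace Summit.ResolutionOfSingularities.ResolutionOfSingularities.Theorems.FInjectiveMacaulayfication.CmLocalizes

/-- **The head of a weakly regular concatenation is weakly regular**: if `List.ofFn (Fin.append x t)`
is weakly regular on `R`, so is `List.ofFn x`. [folklore] -/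
theorem isWeaklyRegular_ofFn_left {R : Type*} [CommRing R] {h e : ℕ} (x : Fin h → R)
    (t : Fin e → R) (hreg : IsWeaklyRegular R (List.ofFn (Fin.append x t))) :
    IsWeaklyRegular R (List.ofFn x) := by
  rw [List.ofFn_fin_append] at hreg
  exact ((isWeaklyRegular_append_iff R (List.ofFn x) (List.ofFn t)).mp hreg).1

/-- **A weakly regular sequence inside `P` becomes a maximal regular sequence of `R_P` when its
length is `ht P`**: if `x : Fin h → R` is weakly regular on `R`, `x ⊆ P` and `ht P = h`, then the
image of `x` in `R_P` is an `R_P`-regular sequence in the maximal ideal of `R_P` of length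
`dim R_P`, i.e. `R_P` is Cohen–Macaulay in the tree's phrasing. [cite: Matsumura1987, Thm 17.3 (iii)] -/
theorem exists_isRegular_localization {R : Type*} [CommRing R] (P : Ideal R) [P.IsPrime] {h : ℕ}
    (x : Fin h → R) (hreg : IsWeaklyRegular R (List.ofFn x)) (hxP : ∀ i, x i ∈ P)
    (hht : P.height = h) :
    ∃ rs : List (Localization.AtPrime P),
      IsRegular (Localization.AtPrime P) rs ∧
        (∀ r ∈ rs, r ∈ maximalIdeal (Localization.AtPrime P)) ∧
        (rs.length : WithBot ℕ∞) = ringKrullDim (Localization.AtPrime P) := by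
  have hmem : ∀ r ∈ List.ofFn x, r ∈ P := List.forall_mem_ofFn_iff.mpr hxP
  refine ⟨(List.ofFn x).map (algebraMap R (Localization.AtPrime P)),
    hreg.isRegular_of_isLocalization_of_mem (Localization.AtPrime P) P hmem, ?_, ?_⟩
  · intro r hr
    obtain ⟨a, ha, rfl⟩ := List.mem_map.mp hr
    exact (IsLocalization.AtPrime.to_map_mem_maximal_iff (Localization.AtPrime P) P a).mpr
      (hmem a ha)
  · rw [List.length_map, List.length_ofFn,
      IsLocalization.AtPrime.ringKrullDim_eq_height P (Localization.AtPrime P), hht]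
    rfl

/-- **Cohen–Macaulayness localizes, s.o.p. form.** If every system of parameters of the Noetherian
local ring `R` is a weakly regular sequence, and the prime `P` of height `h` contains the head
`x : Fin h → R` of a system of parameters `(x, t)` of `R` (and is minimal over `(x)` — not needed),
then every system of parameters of `R_P` is a weakly regular sequence: `x` is weakly regular on `R`
(prefix of `(x, t)`), so its image is an `R_P`-regular sequence inside `P R_P` of length
`h = dim R_P`, and `FRationalModification.SopWeaklyRegular.stub_sopWeaklyRegular`
(Matsumura, Thm 17.4 (iii)) applies to `R_P`. [cite: Matsumura1987, Thm 17.3 (iii)] -/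
theorem stub_cmLocalizes : ∀ (R : Type) [CommRing R] [IsNoetherianRing R] [IsLocalRing R],
    (∀ ⦃n : ℕ⦄ (u : Fin n → R), Literature.RingTheory.TightClosure.IsSystemOfParameters u →
      RingTheory.Sequence.IsWeaklyRegular R (List.ofFn u)) →
    ∀ (P : Ideal R) [P.IsPrime] (h e : ℕ) (x : Fin h → R) (t : Fin e → R),
      Literature.RingTheory.TightClosure.IsSystemOfParameters (Fin.append x t) → (∀ i, x i ∈ P) →
      P ∈ (Ideal.span (Set.range x)).minimalPrimes → P.height = h →
      ∀ ⦃n : ℕ⦄ (u : Fin n → Localization.AtPrime P),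
        Literature.RingTheory.TightClosure.IsSystemOfParameters u →
        RingTheory.Sequence.IsWeaklyRegular (Localization.AtPrime P) (List.ofFn u) := by
  intro R _ _ _ hCM P _ h e x t hxt hxP _ hht n u hu
  exact Summit.ResolutionOfSingularities.ResolutionOfSingularities.Theorems.FRationalModification.SopWeaklyRegular.stub_sopWeaklyRegular
    (exists_isRegular_localization P x (isWeaklyRegular_ofFn_left x t (hCM _ hxt)) hxP hht) u hu

end Summit.ResolutionOfSingularities.ResolutionOfSingularities.Theorems.FInjectiveMacaulayfication.CmLocalizes
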